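import Summits.ResolutionOfSingularities.ResolutionOfSingularities.Theorems.UniversalCellsCampaignW82PrimeFieldTransfer
import Summits.ResolutionOfSingularities.ResolutionOfSingularities.Theorems.UniformComplexityFiniteToClosure
import Summits.ResolutionOfSingularities.ResolutionOfSingularities.Theses.RisoStrata
import Literature.AlgebraicGeometry.Resolution.ResolutionOfComponents
import Mathlib.FieldTheory.Finite.Basic
import Mathlib.Algebra.Algebra.ZMod
import HarnessLib

/-!
# [OURS · L1 W8.2] DOOR 1 FOLLOWS FROM DOOR 2 AND THE GALOIS DESCENT CRUX: `PrimeModelTransfer` (stmt-8933) ∧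
# `DescentAlgclosedToPerfect` (stmt-0550) ⇒ `PrimeFieldToPerfect` (stmt-15233), by name

Cell `res-hironaka` (run/shared/lean/pub/res-hironaka/), LADDER-RESOLUTION rung L (RESCUE), slot W8.2; host route
`UniversalCells`, host item `PrimeFieldToPerfect` (stmt-ResolutionOfSingularities-15233, door 1). Links leaf across
three route files (`Theses.UniversalCells`, `Theses.UniformComplexity`, `Theses.RisoStrata`), written by
res-L1-s82-pv-1 (gen 5). Pure logic over the route decls plus two pieces of bookkeeping (finite push-forward
`Spec 𝔽_q → Spec 𝔽_p`; reduced ⇒ integral components), recording the dependency among the slot's two doors that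
the slot's tables state in prose («door 2 contains door 1's kernel one rung up», Cruxes/PrimeFieldToPerfect/KERNEL.md
§4):

* `integralRes_finiteField_of_primeField` — resolution of integral separated schemes of finite type over `ZMod p`
  gives the same over every FINITE field of characteristic `p` (push forward along the finite `Spec k → Spec 𝔽_p`).
* `primeFieldToPerfect_of_primeModelTransfer_of_descentAlgclosedToPerfect` — **door 1 ⇐ door 2 ∧ stmt-0550**:
  `Res(𝔽_p) ⇒ Res(finite fields)` (push-forward) `⇒ Res(𝔽̄_p)` (`FiniteToClosure`, stmt-8947, PROVED:
  `finiteToClosure_proof`) `⇒ Res(every algebraically closed field of char p)` (`PrimeModelTransfer`, door 2)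
  `⇒ Res(every perfect field of char p)` (`DescentAlgclosedToPerfect`, the Galois descent crux of routes
  `RisoStrata` / `AbhyankarShadows`). So a proof of door 2 leaves door 1 owing EXACTLY Galois descent from `k^{alg}`
  to `k` perfect; conversely door 1 gives door 2's conclusion from door 2's STRONGER antecedent `Res(𝔽_p)`
  (`algClosedRes_of_primeFieldToPerfect`; the gap `Res(𝔽̄_p) ⇒ Res(𝔽_p)` is Galois descent for finite fields,
  not claimed).

HONEST FRAMING. OURS theorem about the ledger's route statements (roles replaced: §17 ¶2 p.89 l.59–62 of
[Hironaka2017], typed AS PRINTED as `S17Methodology.U89_3`); NOT statements of the manuscript; no typed candidate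
used; no crux is asserted — all three enter as hypotheses or conclusions. AI work, weaker than expert review; no
claim beyond the kernel.
-/

noncomputable section

set_option linter.dupNamespace false -- mandated namespace of this single-conjunct summit

open CategoryTheory CategoryTheory.Limits AlgebraicGeometry TopologicalSpace
open Literature.AlgebraicGeometry.Resolution

namespace Summit.ResolutionOfSingularities.ResolutionOfSingularities.Theorems.CampaignW82

/-- **Finite push-forward to the prime field.** If every integral separated scheme of finite type over `ZMod p`
has a resolution, so does every integral separated scheme of finite type over any FINITE field `k` of
characteristic `p`: compose the structure map with the finite (hence finite-type, affine) morphism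
`Spec k → Spec (ZMod p)`; resolutions do not see the base. [folklore] -/
theorem integralRes_finiteField_of_primeField (p : ℕ) [Fact p.Prime]
    (h₀ : ∀ (X : Scheme.{0}) (f : X ⟶ Spec (.of (ZMod p))), IsSeparated f → LocallyOfFiniteType f →
      QuasiCompact f → IsIntegral X → Scheme.HasResolution X)
    (k : Type) [Field k] [CharP k p] [Finite k] (X : Scheme.{0}) (f : X ⟶ Spec (.of k)) (hs : IsSeparated f)
    (hl : LocallyOfFiniteType f) (hq : QuasiCompact f) (hX : IsIntegral X) : Scheme.HasResolution X := by
  letI : Algebra (ZMod p) k := ZMod.algebra k p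
  haveI : Algebra.FiniteType (ZMod p) k := inferInstance
  let g : Spec (.of k) ⟶ Spec (.of (ZMod p)) := Spec.map (CommRingCat.ofHom (algebraMap (ZMod p) k))
  haveI : LocallyOfFiniteType g :=
    (HasRingHomProperty.Spec_iff (P := @LocallyOfFiniteType)).mpr
      (RingHom.finiteType_algebraMap.mpr inferInstance)
  haveI := hs; haveI := hl; haveI := hq
  exact h₀ X (f ≫ g) inferInstance inferInstance inferInstance hX

/-- **DOOR 1 ⇐ DOOR 2 ∧ GALOIS DESCENT.** `UniformComplexity.PrimeModelTransfer` (stmt-ResolutionOfSingularities-8933,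
door 2: `𝔽̄_p ⇒` all algebraically closed fields) and `RisoStrata.DescentAlgclosedToPerfect`
(stmt-ResolutionOfSingularities-0550: algebraically closed `⇒` perfect) imply `UniversalCells.PrimeFieldToPerfect`
(stmt-ResolutionOfSingularities-15233, door 1: `𝔽_p ⇒` perfect), using the PROVED `UniformComplexity.FiniteToClosure`
(stmt-8947, `finiteToClosure_proof`) for the step `𝔽_p ⇒ 𝔽̄_p` and reduced ⇒ integral components
(`hasResolution_of_forall_closeds`) to match the reduced form of stmt-0550's antecedent. [folklore] -/
theorem primeFieldToPerfect_of_primeModelTransfer_of_descentAlgclosedToPerfect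
    (h2 : Summit.ResolutionOfSingularities.ResolutionOfSingularities.Theses.UniformComplexity.PrimeModelTransfer)
    (h3 : Summit.ResolutionOfSingularities.ResolutionOfSingularities.Theses.RisoStrata.DescentAlgclosedToPerfect) :
    Summit.ResolutionOfSingularities.ResolutionOfSingularities.Theses.UniversalCells.PrimeFieldToPerfect := by
  intro p hp h₀ k _ _ _ X f hs hl hq hr
  haveI : Fact p.Prime := ⟨hp⟩
  -- `Res(𝔽_p) ⇒ Res(finite fields) ⇒ Res(𝔽̄_p)` (FiniteToClosure, proved)
  have h1 := finiteToClosure_proof p hp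
    (fun k' _ _ _ Y g a b c d => integralRes_finiteField_of_primeField p h₀ k' Y g a b c d)
  -- `⇒ Res(every algebraically closed field of characteristic p)` (door 2), in reduced form
  have h2' : ∀ (K : Type) [Field K] [CharP K p] [IsAlgClosed K] (Y : Scheme.{0}) (g : Y ⟶ Spec (.of K)),
      IsSeparated g → LocallyOfFiniteType g → QuasiCompact g → IsReduced Y → Scheme.HasResolution Y := by
    intro K _ _ _ Y g _ _ _ _
    refine hasResolution_of_forall_closeds Y g fun Z hZ => ?_
    exact h2 p hp h1 K _ ((Scheme.IdealSheafData.vanishingIdeal Z).subschemeι ≫ g) inferInstance inferInstance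
      inferInstance hZ
  -- `⇒ Res(every perfect field of characteristic p)` (Galois descent crux stmt-0550)
  exact h3 p hp h2' k X f hs hl hq hr

/-- **Conversely, door 1 gives door 2's conclusion from door 2's STRONGER antecedent `Res(𝔽_p)`**: under
`PrimeFieldToPerfect`, resolution of integral separated schemes of finite type over `ZMod p` implies resolution over
every algebraically closed field of characteristic `p` (algebraically closed fields are perfect). The remaining gap
to door 2 itself — whose antecedent is resolution over `𝔽̄_p` only — is Galois descent for finite fields
(`Res(𝔽̄_p) ⇒ Res(𝔽_p)`), not claimed here. [folklore] -/
theorem algClosedRes_of_primeFieldToPerfect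
    (h1 : Summit.ResolutionOfSingularities.ResolutionOfSingularities.Theses.UniversalCells.PrimeFieldToPerfect)
    (p : ℕ) (hp : p.Prime)
    (h₀ : ∀ (X : Scheme.{0}) (f : X ⟶ Spec (.of (ZMod p))), IsSeparated f → LocallyOfFiniteType f →
      QuasiCompact f → IsIntegral X → Scheme.HasResolution X)
    (K : Type) [Field K] [CharP K p] [IsAlgClosed K] (X : Scheme.{0}) (f : X ⟶ Spec (.of K))
    (hs : IsSeparated f) (hl : LocallyOfFiniteType f) (hq : QuasiCompact f) (hX : IsIntegral X) :
    Scheme.HasResolution X := by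
  haveI : PerfectField K := IsAlgClosed.perfectField K
  haveI := hX
  exact h1 p hp h₀ K X f hs hl hq inferInstance

end Summit.ResolutionOfSingularities.ResolutionOfSingularities.Theorems.CampaignW82

end
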